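import Mathlib
import Literature.Analysis.FluidPDE.CheskidovFriedlander2009.GlobalAttractor
import Literature.Analysis.FluidPDE.CheskidovFriedlander2009.DissipationAnomaly
import HarnessLib

/-!
# Cheskidov–Friedlander–Pavlović 2010, §4: the inviscid fixed point is the exponential global
# attractor — Theorem 4.4 PROVED (discharge of `CheskidovFriedlanderPavlovic2010_thm44`), and
# Cheskidov–Friedlander 2009 Thm. 4.1 made unconditional

A. Cheskidov, S. Friedlander, N. Pavlović, *An inviscid dyadic model of turbulence: the global
attractor*, Discrete Contin. Dyn. Syst. 26 (2010) 781–794 = arXiv:math/0610815v1, §4 pp. 6–10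
(Lemma 4.1, Thm. 4.2, (4.29)/(4.31), Thm. 4.4).  The named fact
`CheskidovFriedlanderPavlovic2010_thm44` of `VanishingViscosityLimit.lean` (for the inviscid model
(1.2) with `λ = 2^{5/2}`, i.e. `c = 5/2`, `ν = 0`, force `f₀ > 0` on the first shell: every solution
with `a_j(0) ≥ 0` satisfies `|a(t) − α⁰|² ≤ |a(0) − α⁰|²e^{−β√(2^{5/6}f₀)t}` for a universal `β > 0`)
is PROVED here, following the printed proof step by step, in the scaling-covariant form the fact is
stated in (general `f₀ > 0`; the paper normalises `f₀ = λ^{−1/3}` in (4.1)).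

## The printed proof and its transcription

Write `λ = s³` with `s := λ^{1/3} = 2^{5/6} ∈ (1,2)` (`CFP.s`), `q := s⁻¹ = λ^{−1/3}` (`CFP.q`),
and the fixed point `α_j = Kq^j`, `K = 2^{5/12}√f₀` (`CFP.K`; `K² = sf₀`; `K = 1` in the paper's
normalisation).  The model's scaling `a(t) ↦ κa(κt)`, `f ↦ κ²f` makes every linear term of the
perturbation equation (4.7) carry the factor `K`, and this factor is simply carried along.
* (4.1)–(4.3): `b_j = a_j − α_j`; the telescoping variables, scaled by `λ^{1/6}`:
  `D_0 = b_0`, `D_{j+1} = s^{j+1}b_{j+1} − s^jb_j` (`dSeq`; `d_j = λ^{−1/6}D_j`), `Σ_{l≤j}D_l = s^jb_j`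
  (`sum_dSeq`).
* Lemma 4.1 p. 6, (4.6)–(4.17) pp. 6–8: the perturbation-energy identity (4.7)–(4.10) is the
  tree's CF 2009 (3.7) (`sum_sub_mul_rhs_sub`, `PerturbationEnergy.lean`) at `ν = 0`; completing
  the square (`two_mul_cross_sub`) and the positivity bound (4.11)–(4.12)
  `−λ^kb_k²b_{k+1} ≤ λ^kb_k²α_{k+1}` give (4.4) `Σ_{j≤k}b_j·rhs_j(a) ≤ (Kq/2)(−Σ_{j≤k}D_j² + D²_{k+1})`
  (`inviscid_pert_le`, via the sharp form (4.13) `inviscid_pert_le_sharp`) and, adding the sharp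
  forms at two consecutive levels ((4.15)–(4.17)), (4.5)
  `d/dt(Σ_{j<k}b_j² + ½b_k²) ≤ −KqΣ_{j<k}D_j² − Kλ^{2k/3}b_kb_{k+1}` (`inviscid_pert_le_two_levels`),
  with the cross term bounded through (4.11) `b_j ≥ −α_j` (`neg_mul_le_of_neg_le`; the paper
  writes "`≤ λ^{(k−1)/3}|b|`" — any bound `Cλ^{k/3}` serves, and `C` here comes from the energy
  inequality (3.8), `IsSolution.normSq_le` at `ν = 0`).
* Thm. 4.2 p. 8, proof (4.19)–(4.28) pp. 8–10: integrated in time ((4.20): `inviscid_truncPert_le`;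
  (4.26): `inviscid_truncPert_two_le`; via `IsSolution.truncPert_eq`), the contradiction argument
  — if the truncated decay (4.27) failed for all `k ≥ N` ((4.19)) then `T_{k+1} > (2−θ)T_k`
  ((4.21)–(4.24)) with `T_k = ∫_{t₁}^{t₂}Σ_{j≤k}D_j²`, against `T_k ≤ A + Cs^k` from (4.5) ((4.26)),
  impossible as `(2−θ)/s > 1` — gives, for every `N`, a `k ≥ N` with
  `Σ_{j≤k}b_j(t₂)² − Σ_{j≤k}b_j(t₁)² ≤ −θKq T_k` ((4.27), `exists_trunc_le`; the paper takes
  `α = 2 − λ^{3/8}`, here `θ = (2 − s)/2` (`CFP.θ`) — only `2 − θ > λ^{1/3}` matters), whence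
  ("taking a limit as `N → ∞` and using Levi's convergence theorem", (4.28))
  `|b(t₂)|² − |b(t₁)|² ≤ −θKq∫_{t₁}^{t₂}Σ_{j≤m}D_j²` for every `m` (`normSq_pert_le_dSeq`).
* (4.29)/(4.31) p. 10: Cauchy–Schwarz on (4.3), `Σ_{j≤m}b_j² ≤ S·Σ_{j≤m}D_j²` with
  `S = Σ_j(j+1)q^{2j}` (`sum_sq_le_dSeq`, `CFP.S`), so
  `|b(t₂)|² − |b(t₁)|² ≤ −(θKq/S)∫_{t₁}^{t₂}Σ_{j≤m}b_j²` (4.32) (`normSq_pert_le_trunc`).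
* Thm. 4.4 p. 10, (4.33)–(4.34) "using Gronwall's inequality": as in the discharge of CF 2009 Thm. 3.4
  (`GlobalAttractor.lean`) — `|b|²` is non-increasing, `|b(t)|²(1 + β(t−s)) ≤ |b(s)|²`, discrete
  iteration and `e^{u/2} ≤ 1 + u` — packaged once as `IsSolution.normSq_exp_decay_of_trunc`; the
  delivered rate is `θKq/(2S) = β·√(2^{5/6}f₀)` with the universal `β = θq/(2S)`.

Consequence: Cheskidov–Friedlander 2009 **Thm. 4.1** (the inviscid anomalous dissipation rate
`lim_T T⁻¹∫₀ᵀdε_{a⁰} = ε_d`, at `c = 5/2`), previously derived from the named fact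
(`CheskidovFriedlander2009_thm41_of_thm44`, `DissipationAnomaly.lean`), is now unconditional
(`CheskidovFriedlander2009_thm41`).  No new definitions of notions (only the bookkeeping constants
`CFP.s/q/K/θ/S` and the sequence `dSeq`), no new facts.

## References
* [CheskidovFriedlanderPavlovic2010] A. Cheskidov, S. Friedlander, N. Pavlović, An inviscid
  dyadic model of turbulence: the global attractor, DCDS 26 (2010) 781–794 = arXiv:math/0610815v1,
  §4 pp. 6–10 (locators: arXiv v1 PDF pages and equation numbers, page-confirmed).
* [CheskidovFriedlander2009] A. Cheskidov, S. Friedlander, The vanishing viscosity limit for a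
  dyadic model, Physica D 238 (2009) 783–787, Thm. 4.1 p. 9.
-/

noncomputable section

open Set Filter MeasureTheory Finset
open scoped Topology

namespace Literature.Analysis.FluidPDE.CheskidovFriedlander2009

/-! ### The constants of CFP §4 at `λ = 2^{5/2}` -/

namespace CFP

/-- `s := λ^{1/3} = 2^{5/6}` (`λ = 2^{5/2}`, CFP (1.2)/(1.3)). [cite: CheskidovFriedlanderPavlovic2010, §1 (1.2)–(1.3) p.1 and §4 (4.2) p.6] -/
def s : ℝ := (2 : ℝ) ^ (5 / 6 : ℝ)

/-- `q := λ^{−1/3} = 2^{−5/6} = s⁻¹`, the ratio of the inviscid fixed point `λ^{−j/3}` (CFP (4.1)).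
[cite: CheskidovFriedlanderPavlovic2010, §4 (4.1) p.6] -/
def q : ℝ := (2 : ℝ) ^ (-(5 / 6) : ℝ)

/-- `K := 2^{5/12}√f₀ = √(2^{5/6}f₀)`, the amplitude of the inviscid fixed point `α_j = Kq^j`
(`{2^{−5j/6}2^{5/12}√f₀}`, CFP p. 2; `K = 1` under the normalisation (4.1)).
[cite: CheskidovFriedlanderPavlovic2010, §1 p.2 and §4 (4.1) p.6] -/
def K (f₀ : ℝ) : ℝ := (2 : ℝ) ^ (5 / 12 : ℝ) * Real.sqrt f₀

/-- `θ := (2 − s)/2 ∈ (0,1)`: the fraction of the dissipation kept in Thm. 4.2 (the paper's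
`α = 2 − λ^{3/8}`; what is used is `0 < θ` and `2 − θ > λ^{1/3} = s`).
[cite: CheskidovFriedlanderPavlovic2010, Thm 4.2 p.8] -/
def θ : ℝ := (2 - s) / 2

/-- `S := Σ_j (j+1)q^{2j} = Σ_j λ^{−2j/3}(j+1)`, the constant of (4.28)/(4.31) (up to the factor
`λ^{1/3}` absorbed in `D_j = λ^{1/6}d_j`). [cite: CheskidovFriedlanderPavlovic2010, Thm 4.4 (4.31), (4.33) p.10] -/
def S : ℝ := ∑' j : ℕ, ((j : ℝ) + 1) * (q ^ 2) ^ j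

/-- `s > 0`. [cite: CheskidovFriedlanderPavlovic2010, §4 p.6] -/
theorem s_pos : 0 < s := Real.rpow_pos_of_pos two_pos _

/-- `s = 2^{5/6} > 1`. [cite: CheskidovFriedlanderPavlovic2010, §4 p.6] -/
theorem one_lt_s : 1 < s := Real.one_lt_rpow (by norm_num) (by norm_num)

/-- `s = λ^{1/3} < 2`, i.e. `λ < 2³` ("The proofs of results in section 4 require `λ < 2³`",
Notation, p. 3). [cite: CheskidovFriedlanderPavlovic2010, §1 (Notation) p.3] -/
theorem s_lt_two : s < 2 := by
  have h : (2 : ℝ) ^ (5 / 6 : ℝ) < (2 : ℝ) ^ (1 : ℝ) :=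
    Real.rpow_lt_rpow_of_exponent_lt (by norm_num) (by norm_num)
  rwa [Real.rpow_one] at h

/-- `q > 0`. [cite: CheskidovFriedlanderPavlovic2010, §4 (4.1) p.6] -/
theorem q_pos : 0 < q := Real.rpow_pos_of_pos two_pos _

/-- `q < 1`. [cite: CheskidovFriedlanderPavlovic2010, §4 (4.1) p.6] -/
theorem q_lt_one : q < 1 := Real.rpow_lt_one_of_one_lt_of_neg (by norm_num) (by norm_num)

/-- `sq = 1`. [cite: CheskidovFriedlanderPavlovic2010, §4 (4.1)–(4.2) p.6] -/
theorem s_mul_q : s * q = 1 := by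
  rw [s, q, ← Real.rpow_add two_pos]
  norm_num

/-- `λ = 2^{5/2} = s³`. [cite: CheskidovFriedlanderPavlovic2010, §1 (Notation) p.3 and §4 (4.1) p.6] -/
theorem two_rpow_five_halves : (2 : ℝ) ^ (5 / 2 : ℝ) = s ^ 3 := by
  rw [s, ← Real.rpow_natCast, ← Real.rpow_mul (by norm_num : (0 : ℝ) ≤ 2)]
  norm_num

/-- `K > 0` for `f₀ > 0`. [cite: CheskidovFriedlanderPavlovic2010, §1 p.2] -/
theorem K_pos {f₀ : ℝ} (hf : 0 < f₀) : 0 < K f₀ :=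
  mul_pos (Real.rpow_pos_of_pos two_pos _) (Real.sqrt_pos.mpr hf)

/-- `K ≥ 0`. [cite: CheskidovFriedlanderPavlovic2010, §1 p.2] -/
theorem K_nonneg (f₀ : ℝ) : 0 ≤ K f₀ :=
  mul_nonneg (Real.rpow_pos_of_pos two_pos _).le (Real.sqrt_nonneg _)

/-- `K² = sf₀` (the fixed-point relation `α_0α_1 = f₀`). [cite: CheskidovFriedlanderPavlovic2010, §1 p.2] -/
theorem K_sq {f₀ : ℝ} (hf : 0 ≤ f₀) : K f₀ ^ 2 = s * f₀ := by
  rw [K, mul_pow, Real.sq_sqrt hf, s, ← Real.rpow_natCast, ← Real.rpow_mul (by norm_num : (0 : ℝ) ≤ 2)]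
  norm_num

/-- `K = √(2^{5/6}f₀)` — the form in which the rate of `CheskidovFriedlanderPavlovic2010_thm44` is
typed. [cite: CheskidovFriedlanderPavlovic2010, Thm 4.4 p.10] -/
theorem K_eq_sqrt (f₀ : ℝ) : K f₀ = Real.sqrt ((2 : ℝ) ^ (5 / 6 : ℝ) * f₀) := by
  rw [K, Real.sqrt_mul (Real.rpow_pos_of_pos two_pos _).le, Real.sqrt_eq_rpow ((2 : ℝ) ^ (5 / 6 : ℝ)),
    ← Real.rpow_mul (by norm_num : (0 : ℝ) ≤ 2)]
  norm_num

/-- The tree's inviscid fixed point at `c = 5/2` is `α_j = Kq^j`.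
[cite: CheskidovFriedlanderPavlovic2010, §1 p.2] [cite: CheskidovFriedlander2009, §2 p.4] -/
theorem inviscidFixedPoint_eq (f₀ : ℝ) (j : ℕ) :
    inviscidFixedPoint (5 / 2) f₀ j = K f₀ * q ^ j := by
  rw [inviscidFixedPoint, K, q, show ((5 / 2 : ℝ) / 6) = 5 / 12 by norm_num,
    show (-((5 / 2 : ℝ) / 3)) = -(5 / 6) by norm_num]

/-- The inviscid fixed point is an `ℓ²` fixed point of the model at `c = 5/2`, `ν = 0`
(`isFixedPoint_inviscidFixedPoint`). [cite: CheskidovFriedlanderPavlovic2010, Thm 5.4 p.14] -/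
theorem isFixedPoint {f₀ : ℝ} (hf : 0 ≤ f₀) :
    IsFixedPoint (5 / 2) 0 (force f₀) (inviscidFixedPoint (5 / 2) f₀) :=
  isFixedPoint_inviscidFixedPoint (by norm_num) hf

/-- `0 < θ`. [cite: CheskidovFriedlanderPavlovic2010, Thm 4.2 p.8] -/
theorem θ_pos : 0 < θ := by
  have := s_lt_two
  unfold θ
  linarith

/-- `(2 − θ)/s > 1` — the growth `(2−θ)^j` of (4.24)–(4.25) beats `λ^{(N+j)/3}` of (4.26).
[cite: CheskidovFriedlanderPavlovic2010, Thm 4.2 (4.24)–(4.26) p.9] -/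
theorem one_lt_ratio : 1 < (2 - θ) / s := by
  have h1 := one_lt_s
  have h2 := s_lt_two
  rw [lt_div_iff₀ s_pos, θ]
  linarith

/-- The series `Σ_j(j+1)q^{2j}` converges (`q² < 1`). [cite: CheskidovFriedlanderPavlovic2010, Thm 4.4 (4.31) p.10] -/
theorem summable_S : Summable fun j : ℕ => ((j : ℝ) + 1) * (q ^ 2) ^ j := by
  have hq2 : ‖q ^ 2‖ < 1 := by
    rw [norm_pow, Real.norm_eq_abs, abs_of_pos q_pos]
    exact pow_lt_one₀ q_pos.le q_lt_one two_ne_zero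
  have h1 := summable_pow_mul_geometric_of_norm_lt_one 1 hq2
  have h0 := summable_geometric_of_norm_lt_one hq2
  simpa [pow_one, add_mul] using h1.add h0

/-- `S > 0`. [cite: CheskidovFriedlanderPavlovic2010, Thm 4.4 (4.33) p.10] -/
theorem S_pos : 0 < S := by
  have h := summable_S.sum_le_tsum (Finset.range 1) fun j _ => by positivity
  simp at h
  unfold S
  linarith

/-- Partial sums of `Σ_j(j+1)q^{2j}` are at most `S`. [cite: CheskidovFriedlanderPavlovic2010, Thm 4.4 (4.31) p.10] -/
theorem sum_le_S (m : ℕ) : ∑ j ∈ Finset.range (m + 1), ((j : ℝ) + 1) * (q ^ 2) ^ j ≤ S :=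
  summable_S.sum_le_tsum _ fun j _ => by positivity

end CFP

/-! ### (4.2)–(4.3): the telescoping variables -/

/-- The variables `d_j` of CFP (4.2), scaled by `λ^{1/6}` and written with `s = λ^{1/3}`:
`D_0 = b_0`, `D_{j+1} = s^{j+1}b_{j+1} − s^jb_j` (so `d_j = λ^{−1/6}D_j`).
[cite: CheskidovFriedlanderPavlovic2010, §4 (4.2) p.6] -/
def dSeq (s : ℝ) (b : ℕ → ℝ) : ℕ → ℝ
  | 0 => b 0
  | j + 1 => s ^ (j + 1) * b (j + 1) - s ^ j * b j

/-- `D_0 = b_0`. [cite: CheskidovFriedlanderPavlovic2010, §4 (4.2) p.6] -/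
@[simp] theorem dSeq_zero (s : ℝ) (b : ℕ → ℝ) : dSeq s b 0 = b 0 := rfl

/-- `D_{j+1} = s^{j+1}b_{j+1} − s^jb_j`. [cite: CheskidovFriedlanderPavlovic2010, §4 (4.2) p.6] -/
theorem dSeq_succ (s : ℝ) (b : ℕ → ℝ) (j : ℕ) :
    dSeq s b (j + 1) = s ^ (j + 1) * b (j + 1) - s ^ j * b j := rfl

/-- CFP (4.3): `Σ_{l≤j} D_l = s^jb_j`. [cite: CheskidovFriedlanderPavlovic2010, §4 (4.3) p.6] -/
theorem sum_dSeq (s : ℝ) (b : ℕ → ℝ) (j : ℕ) :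
    ∑ l ∈ range (j + 1), dSeq s b l = s ^ j * b j := by
  induction j with
  | zero => simp
  | succ j ih => rw [sum_range_succ, ih, dSeq_succ]; ring

/-- `b_j² ≤ (j+1)q^{2j}Σ_{l≤j}D_l²` (`sq = 1`; Cauchy–Schwarz on (4.3)) — CFP (4.29) termwise.
[cite: CheskidovFriedlanderPavlovic2010, Thm 4.3 (4.29) p.10] -/
theorem sq_le_dSeq {s q : ℝ} (hsq : s * q = 1) (b : ℕ → ℝ) (j : ℕ) :
    b j ^ 2 ≤ ((j : ℝ) + 1) * (q ^ 2) ^ j * ∑ l ∈ range (j + 1), dSeq s b l ^ 2 := by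
  have hcs : (∑ l ∈ range (j + 1), dSeq s b l) ^ 2 ≤
      (#(range (j + 1)) : ℝ) * ∑ l ∈ range (j + 1), dSeq s b l ^ 2 :=
    _root_.sq_sum_le_card_mul_sum_sq
  rw [sum_dSeq, card_range] at hcs
  push_cast at hcs
  have key : b j ^ 2 = (q ^ 2) ^ j * (s ^ j * b j) ^ 2 := by
    rw [show (q ^ 2) ^ j * (s ^ j * b j) ^ 2 = (s * q) ^ (2 * j) * b j ^ 2 by ring,
      hsq, one_pow, one_mul]
  rw [key]
  have hq : 0 ≤ (q ^ 2) ^ j := by positivity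
  calc (q ^ 2) ^ j * (s ^ j * b j) ^ 2
      ≤ (q ^ 2) ^ j * (((j : ℝ) + 1) * ∑ l ∈ range (j + 1), dSeq s b l ^ 2) :=
        mul_le_mul_of_nonneg_left hcs hq
    _ = ((j : ℝ) + 1) * (q ^ 2) ^ j * ∑ l ∈ range (j + 1), dSeq s b l ^ 2 := by ring

/-- Finite form of CFP (4.31): `Σ_{j≤m} b_j² ≤ (Σ_{j≤m}(j+1)q^{2j})·Σ_{l≤m}D_l²`.
[cite: CheskidovFriedlanderPavlovic2010, Thm 4.4 (4.31) p.10] -/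
theorem sum_sq_le_dSeq {s q : ℝ} (hsq : s * q = 1) (b : ℕ → ℝ) (m : ℕ) :
    ∑ j ∈ range (m + 1), b j ^ 2 ≤
      (∑ j ∈ range (m + 1), ((j : ℝ) + 1) * (q ^ 2) ^ j) * ∑ l ∈ range (m + 1), dSeq s b l ^ 2 := by
  rw [sum_mul]
  refine sum_le_sum fun j hj => ?_
  have hjm : j + 1 ≤ m + 1 := by rw [Finset.mem_range] at hj; omega
  have hq : 0 ≤ ((j : ℝ) + 1) * (q ^ 2) ^ j := by positivity
  calc b j ^ 2 ≤ ((j : ℝ) + 1) * (q ^ 2) ^ j * ∑ l ∈ range (j + 1), dSeq s b l ^ 2 :=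
        sq_le_dSeq hsq b j
    _ ≤ ((j : ℝ) + 1) * (q ^ 2) ^ j * ∑ l ∈ range (m + 1), dSeq s b l ^ 2 :=
        mul_le_mul_of_nonneg_left
          (sum_le_sum_of_subset_of_nonneg (range_mono hjm) fun _ _ _ => sq_nonneg _) hq

/-! ### Lemma 4.1: the algebra (any force, any `K`) -/

/-- Completing the square (CFP, the unnumbered display between (4.9) and (4.10)): for every `k`,
`2sΣ_{j<k}s^{2j}b_jb_{j+1} − 2Σ_{j≤k}s^{2j}b_j² = −(Σ_{j≤k}D_j² + s^{2k}b_k²)`.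
[cite: CheskidovFriedlanderPavlovic2010, Lemma 4.1 (4.9)–(4.10) p.7] -/
theorem two_mul_cross_sub (s : ℝ) (b : ℕ → ℝ) (k : ℕ) :
    2 * s * ∑ j ∈ range k, s ^ (2 * j) * b j * b (j + 1)
        - 2 * ∑ j ∈ range (k + 1), s ^ (2 * j) * b j ^ 2 =
      -(∑ j ∈ range (k + 1), dSeq s b j ^ 2 + s ^ (2 * k) * b k ^ 2) := by
  induction k with
  | zero => rw [sum_range_zero, sum_range_one, sum_range_one, dSeq_zero]; ring
  | succ k ih =>
    rw [sum_range_succ, sum_range_succ _ (k + 1), sum_range_succ _ (k + 1), dSeq_succ]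
    linear_combination ih

/-- **CF (3.7) for the inviscid model** with `2^c = s³` and a fixed point of the shape `α_j = Kq^j`,
`sq = 1` (CFP (4.7)–(4.10) with the force carried — every linear term acquires the factor `K`):
`Σ_{j≤k} b_j(rhs_j(α+b) − rhs_j(α)) = −(Kq/2)(Σ_{j≤k}D_j² + s^{2k}b_k²) − Ks^{2k}b_kb_{k+1} − s^{3k}b_k²b_{k+1}`.
[cite: CheskidovFriedlanderPavlovic2010, Lemma 4.1 (4.7)–(4.10) p.6–7] [cite: CheskidovFriedlander2009, Thm 3.4 (3.7) p.8] -/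
theorem inviscid_pert_identity {c s q K : ℝ} (hp : (2 : ℝ) ^ c = s ^ 3) (hsq : s * q = 1)
    (f α b : ℕ → ℝ) (hα : ∀ i, α i = K * q ^ i) (k : ℕ) :
    ∑ j ∈ range (k + 1), b j * (rhs c 0 f (fun i => α i + b i) j - rhs c 0 f α j) =
      -(K * q / 2) * (∑ j ∈ range (k + 1), dSeq s b j ^ 2 + s ^ (2 * k) * b k ^ 2)
        - K * s ^ (2 * k) * b k * b (k + 1) - (s ^ 3) ^ k * b k ^ 2 * b (k + 1) := by
  rw [sum_sub_mul_rhs_sub, hp]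
  have hpow : ∀ j : ℕ, (s * q) ^ j = 1 := fun j => by rw [hsq, one_pow]
  have hA : ∑ j ∈ range (k + 1), (s ^ 3) ^ j * α (j + 1) * b j ^ 2 =
      K * q * ∑ j ∈ range (k + 1), s ^ (2 * j) * b j ^ 2 := by
    rw [mul_sum]
    refine sum_congr rfl fun j _ => ?_
    rw [hα]
    calc (s ^ 3) ^ j * (K * q ^ (j + 1)) * b j ^ 2
        = K * q * (s ^ (2 * j) * b j ^ 2) * (s * q) ^ j := by ring
      _ = K * q * (s ^ (2 * j) * b j ^ 2) := by rw [hpow, mul_one]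
  have hB : ∑ j ∈ range k, (s ^ 3) ^ j * α j * b j * b (j + 1) =
      K * ∑ j ∈ range k, s ^ (2 * j) * b j * b (j + 1) := by
    rw [mul_sum]
    refine sum_congr rfl fun j _ => ?_
    rw [hα]
    calc (s ^ 3) ^ j * (K * q ^ j) * b j * b (j + 1)
        = K * (s ^ (2 * j) * b j * b (j + 1)) * (s * q) ^ j := by ring
      _ = K * (s ^ (2 * j) * b j * b (j + 1)) := by rw [hpow, mul_one]
  have hC : (s ^ 3) ^ k * α k = K * s ^ (2 * k) := by
    rw [hα]
    calc (s ^ 3) ^ k * (K * q ^ k) = K * s ^ (2 * k) * (s * q) ^ k := by ring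
      _ = K * s ^ (2 * k) := by rw [hpow, mul_one]
  have hCS := two_mul_cross_sub s b k
  rw [hA, hB]
  linear_combination (K * q / 2) * hCS - (b k * b (k + 1)) * hC
    - (K * ∑ j ∈ range k, s ^ (2 * j) * b j * b (j + 1)) * hsq

/-- **Lemma 4.1, sharp form** ((4.13), with its last term `−½λ^{2k/3+1/3}b²_{k+1}` expanded by
(4.14) — the second line of (4.15)): with `2^c = s³`, `sq = 1`, `s > 0`, a fixed point `α_j = Kq^j`
and any `b` with `b_{k+1} ≥ −α_{k+1}` ((4.11), i.e. `a_{k+1} ≥ 0`),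
`Σ_{j≤k} b_j(rhs_j(α+b) − rhs_j(α)) ≤ −(Kq/2)Σ_{j≤k}D_j² + (Kq/2)s^{2k}b_k² − Ks^{2k}b_kb_{k+1}`
(the cubic boundary term `−λ^kb_k²b_{k+1}` is at most `λ^kb_k²α_{k+1} = Kq·s^{2k}b_k²`, (4.12)).
[cite: CheskidovFriedlanderPavlovic2010, Lemma 4.1 (4.11)–(4.15) p.7–8] -/
theorem inviscid_pert_le_sharp {c s q K : ℝ} (hp : (2 : ℝ) ^ c = s ^ 3) (hsq : s * q = 1)
    (hs : 0 < s) (f α b : ℕ → ℝ) (hα : ∀ i, α i = K * q ^ i) (k : ℕ)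
    (hb : -α (k + 1) ≤ b (k + 1)) :
    ∑ j ∈ range (k + 1), b j * (rhs c 0 f (fun i => α i + b i) j - rhs c 0 f α j) ≤
      -(K * q / 2) * ∑ j ∈ range (k + 1), dSeq s b j ^ 2 + (K * q / 2) * s ^ (2 * k) * b k ^ 2
        - K * s ^ (2 * k) * b k * b (k + 1) := by
  rw [inviscid_pert_identity hp hsq f α b hα k]
  have hpow : (s * q) ^ k = 1 := by rw [hsq, one_pow]
  have hnn : 0 ≤ (s ^ 3) ^ k * b k ^ 2 := by positivity
  rw [hα] at hb
  -- `−λ^k b_k² b_{k+1} ≤ λ^k b_k² · Kq^{k+1} = Kq s^{2k} b_k²`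
  have h1 : -((s ^ 3) ^ k * b k ^ 2 * b (k + 1)) ≤ (s ^ 3) ^ k * b k ^ 2 * (K * q ^ (k + 1)) := by
    have := mul_le_mul_of_nonneg_left hb hnn
    linarith
  have h2 : (s ^ 3) ^ k * b k ^ 2 * (K * q ^ (k + 1)) = K * q * s ^ (2 * k) * b k ^ 2 := by
    calc (s ^ 3) ^ k * b k ^ 2 * (K * q ^ (k + 1))
        = K * q * s ^ (2 * k) * b k ^ 2 * (s * q) ^ k := by ring
      _ = K * q * s ^ (2 * k) * b k ^ 2 := by rw [hpow, mul_one]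
  rw [h2] at h1
  linarith

/-- **Lemma 4.1 (4.4)** (scaling-covariant; `D_j = λ^{1/6}d_j`): under the hypotheses of
`inviscid_pert_le_sharp` and `K, q ≥ 0`,
`Σ_{j≤k} b_j(rhs_j(α+b) − rhs_j(α)) ≤ (Kq/2)(−Σ_{j≤k}D_j² + D²_{k+1})` — i.e.
`d/dt Σ_{j≤k}b_j² ≤ −Σ_{j≤k}d_j² + d²_{k+1}` at `K = 1`.
[cite: CheskidovFriedlanderPavlovic2010, Lemma 4.1 (4.4) p.6 and (4.13) p.7] -/
theorem inviscid_pert_le {c s q K : ℝ} (hp : (2 : ℝ) ^ c = s ^ 3) (hsq : s * q = 1)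
    (hs : 0 < s) (hK : 0 ≤ K) (hq : 0 ≤ q) (f α b : ℕ → ℝ) (hα : ∀ i, α i = K * q ^ i) (k : ℕ)
    (hb : -α (k + 1) ≤ b (k + 1)) :
    ∑ j ∈ range (k + 1), b j * (rhs c 0 f (fun i => α i + b i) j - rhs c 0 f α j) ≤
      (K * q / 2) * (-(∑ j ∈ range (k + 1), dSeq s b j ^ 2) + dSeq s b (k + 1) ^ 2) := by
  have h := inviscid_pert_le_sharp hp hsq hs f α b hα k hb
  -- `(Kq/2)s^{2k}b_k² − Ks^{2k}b_kb_{k+1} = (Kq/2)(D²_{k+1} − s^{2k+2}b²_{k+1})` using `K = Kqs`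
  have e : (K * q / 2) * dSeq s b (k + 1) ^ 2 = (K * q / 2) * s ^ (2 * k) * b k ^ 2
      - K * (s * q) * s ^ (2 * k) * b k * b (k + 1)
      + (K * q / 2) * s ^ (2 * (k + 1)) * b (k + 1) ^ 2 := by
    rw [dSeq_succ]; ring
  rw [hsq, mul_one] at e
  have hnn : 0 ≤ (K * q / 2) * s ^ (2 * (k + 1)) * b (k + 1) ^ 2 := by positivity
  linarith

/-- **Lemma 4.1 (4.5)** (scaling-covariant; the sharp forms at levels `k+1` and `k` added, as in
the printed proof (4.15)–(4.17)): under the hypotheses of `inviscid_pert_le_sharp` at both levels,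
`Σ_{j≤k+1} b_jG_j + Σ_{j≤k} b_jG_j ≤ −KqΣ_{j≤k}D_j² − Ks^{2(k+1)}b_{k+1}b_{k+2}`
(`G = rhs(α+b) − rhs(α)`), i.e. `d/dt(Σ_{j≤k}b_j² + ½b²_{k+1}) ≤ −KqΣ_{j≤k}D_j² − Kλ^{2(k+1)/3}b_{k+1}b_{k+2}`
(the first line of (4.17)).
[cite: CheskidovFriedlanderPavlovic2010, Lemma 4.1 (4.5) p.6 and (4.15)–(4.17) p.8] -/
theorem inviscid_pert_le_two_levels {c s q K : ℝ} (hp : (2 : ℝ) ^ c = s ^ 3) (hsq : s * q = 1)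
    (hs : 0 < s) (f α b : ℕ → ℝ) (hα : ∀ i, α i = K * q ^ i) (k : ℕ)
    (hb1 : -α (k + 1) ≤ b (k + 1)) (hb2 : -α (k + 2) ≤ b (k + 2)) :
    ∑ j ∈ range (k + 2), b j * (rhs c 0 f (fun i => α i + b i) j - rhs c 0 f α j)
      + ∑ j ∈ range (k + 1), b j * (rhs c 0 f (fun i => α i + b i) j - rhs c 0 f α j) ≤
      -(K * q) * ∑ j ∈ range (k + 1), dSeq s b j ^ 2
        - K * s ^ (2 * (k + 1)) * b (k + 1) * b (k + 2) := by
  have h1 := inviscid_pert_le_sharp hp hsq hs f α b hα (k + 1) hb2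
  have h0 := inviscid_pert_le_sharp hp hsq hs f α b hα k hb1
  rw [sum_range_succ (fun j => dSeq s b j ^ 2) (k + 1), dSeq_succ] at h1
  rw [show k + 2 = k + 1 + 1 from rfl]
  have e2 : (K * q / 2) * (s ^ (k + 1) * b (k + 1) - s ^ k * b k) ^ 2 =
      (K * q / 2) * s ^ (2 * (k + 1)) * b (k + 1) ^ 2 - K * (s * q) * s ^ (2 * k) * b k * b (k + 1)
        + (K * q / 2) * s ^ (2 * k) * b k ^ 2 := by ring
  rw [hsq, mul_one] at e2
  linarith

/-- The boundary cross term against the lower bounds `b_k ≥ −α_k`, `b_{k+1} ≥ −α_{k+1}`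
(positivity of `a`, (4.11)): `−b_kb_{k+1} ≤ α_k|b_{k+1}| + α_{k+1}|b_k|` (the last step of (4.17),
"`≤ λ^{(k−1)/3}|b|`"). [cite: CheskidovFriedlanderPavlovic2010, Lemma 4.1 (4.11) p.7 and (4.17) p.8] -/
theorem neg_mul_le_of_neg_le {u v A B : ℝ} (hA : 0 ≤ A) (hB : 0 ≤ B) (hu : -A ≤ u) (hv : -B ≤ v) :
    -(u * v) ≤ A * |v| + B * |u| := by
  rcases le_or_gt 0 u with hu0 | hu0 <;> rcases le_or_gt 0 v with hv0 | hv0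
  · rw [abs_of_nonneg hu0, abs_of_nonneg hv0]
    nlinarith [mul_nonneg hu0 hv0]
  · rw [abs_of_nonneg hu0, abs_of_neg hv0]
    nlinarith [mul_nonneg hu0 (by linarith : 0 ≤ v + B)]
  · rw [abs_of_neg hu0, abs_of_nonneg hv0]
    nlinarith [mul_nonneg hv0 (by linarith : 0 ≤ u + A)]
  · rw [abs_of_neg hu0, abs_of_neg hv0]
    nlinarith [mul_pos_of_neg_of_neg hu0 hv0]

/-- `|x| ≤ (1 + x²)/2` (private arithmetic helper). [folklore] -/
private theorem abs_le_one_add_sq_half (x : ℝ) : |x| ≤ (1 + x ^ 2) / 2 := by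
  have h : 0 ≤ (|x| - 1) ^ 2 := sq_nonneg _
  have h2 : |x| ^ 2 = x ^ 2 := sq_abs x
  nlinarith

/-! ### The inviscid model at `c = 5/2`: the integrated inequalities (Thm. 4.2, first steps) -/

variable {f₀ : ℝ} {a : ℕ → ℝ → ℝ}

/-- Each `D_j(τ)` (`b = a(τ) − α`) is continuous in `τ` along a solution.
[cite: CheskidovFriedlanderPavlovic2010, Def 3.1 p.4 and (4.2) p.6] -/
theorem IsSolution.continuousOn_dSeq {c ν : ℝ} {f : ℕ → ℝ} (ha : IsSolution c ν f a) (s : ℝ)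
    (α : ℕ → ℝ) (j : ℕ) :
    ContinuousOn (fun τ => dSeq s (fun i => a i τ - α i) j) (Ici 0) := by
  have hc := ha.continuousOn
  cases j with
  | zero =>
    show ContinuousOn (fun τ => a 0 τ - α 0) (Ici 0)
    exact (hc 0).sub continuousOn_const
  | succ j =>
    show ContinuousOn (fun τ => s ^ (j + 1) * (a (j + 1) τ - α (j + 1)) - s ^ j * (a j τ - α j)) (Ici 0)
    exact (continuousOn_const.mul ((hc (j + 1)).sub continuousOn_const)).sub
      (continuousOn_const.mul ((hc j).sub continuousOn_const))

/-- `|x − y|² ≤ 2|x|² + 2|y|²` in `ℓ²`. [cite: CheskidovFriedlanderPavlovic2010, §2 (2.1) p.3] -/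
theorem normSq_sub_le {x y : ℕ → ℝ} (hx : Summable fun j => x j ^ 2)
    (hy : Summable fun j => y j ^ 2) :
    normSq (fun j => x j - y j) ≤ 2 * normSq x + 2 * normSq y := by
  unfold normSq
  rw [← tsum_mul_left, ← tsum_mul_left, ← (hx.mul_left 2).tsum_add (hy.mul_left 2)]
  refine (summable_sq_sub_of_sq hx hy).tsum_le_tsum (fun j => ?_) ((hx.mul_left 2).add (hy.mul_left 2))
  nlinarith [sq_nonneg (x j + y j)]

/-- **A priori bound on the perturbation** (from the energy inequality, Thm. 3.3, at `ν = 0`):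
along a solution with non-negative datum, `|a(τ) − α|²` is bounded on every `[0,T]`
(by `2(|a(0)|² + 2f₀∫₀ᵀa₀) + 2|α|²`). [cite: CheskidovFriedlanderPavlovic2010, Thm 3.3 (3.8) p.5] -/
theorem exists_normSq_pert_le (hf : 0 < f₀) (ha : IsSolution (5 / 2) 0 (force f₀) a)
    (h0 : ∀ j, 0 ≤ a j 0) {T : ℝ} (hT : 0 ≤ T) :
    ∃ B : ℝ, 0 ≤ B ∧ ∀ τ, 0 ≤ τ → τ ≤ T →
      normSq (fun j => a j τ - inviscidFixedPoint (5 / 2) f₀ j) ≤ B := by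
  set α : ℕ → ℝ := inviscidFixedPoint (5 / 2) f₀ with hαdef
  have hαsum : Summable fun j => α j ^ 2 := (CFP.isFixedPoint hf.le).1
  have hc0 : (5 / 2 : ℝ) ≠ 0 := by norm_num
  set I : ℝ := ∫ τ in (0 : ℝ)..T, a 0 τ with hI
  have ha0i : IntervalIntegrable (a 0) volume 0 T :=
    ((ha.continuousOn 0).mono fun τ hτ => hτ.1).intervalIntegrable_of_Icc hT
  have hE0 : 0 ≤ normSq (fun j => a j 0) := tsum_nonneg fun j => sq_nonneg _
  have hEα : 0 ≤ normSq α := tsum_nonneg fun j => sq_nonneg _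
  have hI0 : 0 ≤ I :=
    intervalIntegral.integral_nonneg hT fun τ hτ => ha.nonneg hc0 hf.le h0 0 τ hτ.1
  refine ⟨2 * (normSq (fun j => a j 0) + 2 * f₀ * I) + 2 * normSq α, by positivity, ?_⟩
  intro τ hτ0 hτT
  have h1 : normSq (fun j => a j τ) ≤ normSq (fun j => a j 0) + 2 * f₀ * ∫ σ in (0 : ℝ)..τ, a 0 σ :=
    ha.normSq_le hc0 le_rfl hf.le h0 le_rfl hτ0
  have h2 : (∫ σ in (0 : ℝ)..τ, a 0 σ) ≤ I := by
    refine intervalIntegral.integral_mono_interval le_rfl hτ0 hτT ?_ ha0i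
    rw [Filter.EventuallyLE, ae_restrict_iff' measurableSet_Ioc]
    exact ae_of_all _ fun σ hσ => ha.nonneg hc0 hf.le h0 0 σ hσ.1.le
  have h3 := normSq_sub_le (ha.summable_sq τ hτ0) hαsum
  nlinarith

/-- **(4.4) integrated, = (4.20)** (scaling-covariant): for a solution of the inviscid model
(`c = 5/2`, force `f₀ > 0`) with non-negative datum, `b = a − α⁰`, `0 ≤ t₁ ≤ t₂` and every `k`,
`Σ_{j≤k}b_j(t₂)² − Σ_{j≤k}b_j(t₁)² ≤ Kq(T_{k+1} − 2T_k)`, `T_k = ∫_{t₁}^{t₂}Σ_{j≤k}D_j²`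
(`= −∫Σ_{j≤k}d_j² + ∫d²_{k+1}` at `K = 1`). [cite: CheskidovFriedlanderPavlovic2010, Thm 4.2 (4.20) p.8] -/
theorem inviscid_truncPert_le (hf : 0 < f₀) (ha : IsSolution (5 / 2) 0 (force f₀) a)
    (h0 : ∀ j, 0 ≤ a j 0) (k : ℕ) {t₁ t₂ : ℝ} (ht₁ : 0 ≤ t₁) (h12 : t₁ ≤ t₂) :
    ∑ j ∈ range (k + 1), (a j t₂ - inviscidFixedPoint (5 / 2) f₀ j) ^ 2
        - ∑ j ∈ range (k + 1), (a j t₁ - inviscidFixedPoint (5 / 2) f₀ j) ^ 2 ≤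
      CFP.K f₀ * CFP.q *
        ((∫ τ in t₁..t₂, ∑ j ∈ range (k + 1 + 1),
            dSeq CFP.s (fun i => a i τ - inviscidFixedPoint (5 / 2) f₀ i) j ^ 2)
          - 2 * ∫ τ in t₁..t₂, ∑ j ∈ range (k + 1),
            dSeq CFP.s (fun i => a i τ - inviscidFixedPoint (5 / 2) f₀ i) j ^ 2) := by
  set α : ℕ → ℝ := inviscidFixedPoint (5 / 2) f₀ with hαdef
  have hαfix : IsFixedPoint (5 / 2) 0 (force f₀) α := CFP.isFixedPoint hf.le
  have hαK : ∀ i, α i = CFP.K f₀ * CFP.q ^ i := CFP.inviscidFixedPoint_eq f₀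
  have hc0 : (5 / 2 : ℝ) ≠ 0 := by norm_num
  have hcont := ha.continuousOn
  have hst' : Icc t₁ t₂ ⊆ Ici 0 := fun τ hτ => ht₁.trans hτ.1
  have hK := CFP.K_nonneg f₀
  have hq := CFP.q_pos.le
  -- the players
  obtain ⟨G, hG⟩ : ∃ G : ℝ → ℝ, G = fun τ => 2 * ∑ j ∈ range (k + 1),
      (a j τ - α j) * (rhs (5 / 2) 0 (force f₀) (fun i => a i τ) j - rhs (5 / 2) 0 (force f₀) α j) :=
    ⟨_, rfl⟩
  obtain ⟨P, hP⟩ : ∃ P : ℕ → ℝ → ℝ, P = fun n τ => ∑ j ∈ range (n + 1),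
      dSeq CFP.s (fun i => a i τ - α i) j ^ 2 := ⟨_, rfl⟩
  have hGc : ContinuousOn G (Ici 0) := by
    rw [hG]
    exact continuousOn_const.mul (continuousOn_finsetSum _ fun j _ =>
      ((hcont j).sub continuousOn_const).mul ((ha.continuousOn_rhs j).sub continuousOn_const))
  have hPc : ∀ n, ContinuousOn (P n) (Ici 0) := fun n => by
    rw [hP]
    exact continuousOn_finsetSum _ fun j _ => (ha.continuousOn_dSeq CFP.s α j).pow 2
  have hGi : IntervalIntegrable G volume t₁ t₂ := (hGc.mono hst').intervalIntegrable_of_Icc h12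
  have hPi : ∀ n, IntervalIntegrable (P n) volume t₁ t₂ := fun n =>
    ((hPc n).mono hst').intervalIntegrable_of_Icc h12
  -- pointwise: Lemma 4.1 (4.5)
  have hpt : ∀ τ ∈ Icc t₁ t₂, G τ ≤ CFP.K f₀ * CFP.q * (P (k + 1) τ - 2 * P k τ) := by
    intro τ hτ
    have hτ0 : 0 ≤ τ := ht₁.trans hτ.1
    have hb : -α (k + 1) ≤ a (k + 1) τ - α (k + 1) := by
      have := ha.nonneg hc0 hf.le h0 (k + 1) τ hτ0
      linarith
    have h := inviscid_pert_le CFP.two_rpow_five_halves CFP.s_mul_q CFP.s_pos hK hq (force f₀) α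
      (fun i => a i τ - α i) hαK k hb
    have hfun : (fun i => α i + (a i τ - α i)) = fun i => a i τ := by
      funext i; ring
    rw [hfun] at h
    have hPk : P k τ = ∑ j ∈ range (k + 1), dSeq CFP.s (fun i => a i τ - α i) j ^ 2 := by rw [hP]
    have hPk1 : P (k + 1) τ = ∑ j ∈ range (k + 1), dSeq CFP.s (fun i => a i τ - α i) j ^ 2
        + dSeq CFP.s (fun i => a i τ - α i) (k + 1) ^ 2 := by
      rw [hP]
      simp only [Finset.sum_range_succ _ (k + 1)]
    have hGτ : G τ = 2 * ∑ j ∈ range (k + 1),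
        (a j τ - α j) * (rhs (5 / 2) 0 (force f₀) (fun i => a i τ) j - rhs (5 / 2) 0 (force f₀) α j) := by
      rw [hG]
    rw [hGτ, hPk, hPk1]
    linarith
  have hI : (∫ τ in t₁..t₂, G τ) ≤ ∫ τ in t₁..t₂, CFP.K f₀ * CFP.q * (P (k + 1) τ - 2 * P k τ) :=
    intervalIntegral.integral_mono_on h12 hGi
      (((hPi (k + 1)).sub ((hPi k).const_mul 2)).const_mul _) hpt
  have hR : (∫ τ in t₁..t₂, CFP.K f₀ * CFP.q * (P (k + 1) τ - 2 * P k τ)) =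
      CFP.K f₀ * CFP.q * ((∫ τ in t₁..t₂, P (k + 1) τ) - 2 * ∫ τ in t₁..t₂, P k τ) := by
    rw [intervalIntegral.integral_const_mul, intervalIntegral.integral_sub (hPi (k + 1))
      ((hPi k).const_mul 2), intervalIntegral.integral_const_mul]
  rw [hR] at hI
  rw [ha.truncPert_eq hαfix k ht₁ h12]
  subst hG hP
  simpa only using hI

/-- **(4.5) integrated** (the first inequality of (4.26), scaling-covariant, with the paper's
`λ^{(N+j)/3}M`, `M = (t₂−t₁)sup|b|`, replaced by an explicit bound from `|b(τ)|² ≤ B` on `[0,t₂]`):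
with the data of `inviscid_truncPert_le`, for every `k`,
`(Σ_{j≤k}b_j² + Σ_{j≤k+1}b_j²)(t₂) − (same)(t₁) ≤ −2Kq∫_{t₁}^{t₂}Σ_{j≤k}D_j² + 2K²(1+B)(t₂−t₁)s^{k+1}`.
[cite: CheskidovFriedlanderPavlovic2010, Thm 4.2 (4.26) p.9 and Lemma 4.1 (4.5) p.6] -/
theorem inviscid_truncPert_two_le (hf : 0 < f₀) (ha : IsSolution (5 / 2) 0 (force f₀) a)
    (h0 : ∀ j, 0 ≤ a j 0) (k : ℕ) {t₁ t₂ : ℝ} (ht₁ : 0 ≤ t₁) (h12 : t₁ ≤ t₂) {B : ℝ}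
    (hB : ∀ τ, 0 ≤ τ → τ ≤ t₂ → normSq (fun j => a j τ - inviscidFixedPoint (5 / 2) f₀ j) ≤ B) :
    (∑ j ∈ range (k + 1), (a j t₂ - inviscidFixedPoint (5 / 2) f₀ j) ^ 2
        + ∑ j ∈ range (k + 1 + 1), (a j t₂ - inviscidFixedPoint (5 / 2) f₀ j) ^ 2)
      - (∑ j ∈ range (k + 1), (a j t₁ - inviscidFixedPoint (5 / 2) f₀ j) ^ 2
        + ∑ j ∈ range (k + 1 + 1), (a j t₁ - inviscidFixedPoint (5 / 2) f₀ j) ^ 2) ≤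
      -(2 * (CFP.K f₀ * CFP.q)) * (∫ τ in t₁..t₂, ∑ j ∈ range (k + 1),
            dSeq CFP.s (fun i => a i τ - inviscidFixedPoint (5 / 2) f₀ i) j ^ 2)
        + 2 * CFP.K f₀ ^ 2 * (1 + B) * (t₂ - t₁) * CFP.s ^ (k + 1) := by
  set α : ℕ → ℝ := inviscidFixedPoint (5 / 2) f₀ with hαdef
  have hαfix : IsFixedPoint (5 / 2) 0 (force f₀) α := CFP.isFixedPoint hf.le
  have hαsum : Summable fun j => α j ^ 2 := hαfix.1
  have hαK : ∀ i, α i = CFP.K f₀ * CFP.q ^ i := CFP.inviscidFixedPoint_eq f₀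
  have hc0 : (5 / 2 : ℝ) ≠ 0 := by norm_num
  have hcont := ha.continuousOn
  have hst' : Icc t₁ t₂ ⊆ Ici 0 := fun τ hτ => ht₁.trans hτ.1
  have hK := CFP.K_nonneg f₀
  have hq := CFP.q_pos.le
  have hs := CFP.s_pos
  have hsq := CFP.s_mul_q
  -- the players
  obtain ⟨G, hG⟩ : ∃ G : ℕ → ℝ → ℝ, G = fun n τ => 2 * ∑ j ∈ range (n + 1),
      (a j τ - α j) * (rhs (5 / 2) 0 (force f₀) (fun i => a i τ) j - rhs (5 / 2) 0 (force f₀) α j) :=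
    ⟨_, rfl⟩
  obtain ⟨P, hP⟩ : ∃ P : ℝ → ℝ, P = fun τ => ∑ j ∈ range (k + 1),
      dSeq CFP.s (fun i => a i τ - α i) j ^ 2 := ⟨_, rfl⟩
  obtain ⟨C, hC⟩ : ∃ C : ℝ, C = 2 * CFP.K f₀ ^ 2 * (1 + B) * CFP.s ^ (k + 1) := ⟨_, rfl⟩
  have hGc : ∀ n, ContinuousOn (G n) (Ici 0) := fun n => by
    rw [hG]
    exact continuousOn_const.mul (continuousOn_finsetSum _ fun j _ =>
      ((hcont j).sub continuousOn_const).mul ((ha.continuousOn_rhs j).sub continuousOn_const))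
  have hPc : ContinuousOn P (Ici 0) := by
    rw [hP]
    exact continuousOn_finsetSum _ fun j _ => (ha.continuousOn_dSeq CFP.s α j).pow 2
  have hGi : ∀ n, IntervalIntegrable (G n) volume t₁ t₂ := fun n =>
    ((hGc n).mono hst').intervalIntegrable_of_Icc h12
  have hPi : IntervalIntegrable P volume t₁ t₂ := (hPc.mono hst').intervalIntegrable_of_Icc h12
  -- pointwise: Lemma 4.1 (4.6) with the cross term bounded
  have hpt : ∀ τ ∈ Icc t₁ t₂, G (k + 1) τ + G k τ ≤ -(2 * (CFP.K f₀ * CFP.q)) * P τ + C := by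
    intro τ hτ
    have hτ0 : 0 ≤ τ := ht₁.trans hτ.1
    have hpos := fun j => ha.nonneg hc0 hf.le h0 j τ hτ0
    have hb1 : -α (k + 1) ≤ a (k + 1) τ - α (k + 1) := by linarith [hpos (k + 1)]
    have hb2 : -α (k + 2) ≤ a (k + 2) τ - α (k + 2) := by linarith [hpos (k + 2)]
    have h := inviscid_pert_le_two_levels CFP.two_rpow_five_halves hsq hs (force f₀) α
      (fun i => a i τ - α i) hαK k hb1 hb2
    have hfun : (fun i => α i + (a i τ - α i)) = fun i => a i τ := by
      funext i; ring
    rw [hfun] at h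
    -- the cross term: `−b_{k+1}b_{k+2} ≤ α_{k+1}|b_{k+2}| + α_{k+2}|b_{k+1}| ≤ α_{k+1}(1 + B)`
    have hαnn : ∀ j, 0 ≤ α j := fun j => by rw [hαK]; positivity
    have hcross := neg_mul_le_of_neg_le (hαnn (k + 1)) (hαnn (k + 2)) hb1 hb2
    have hBτ := hB τ hτ0 hτ.2
    have hsumτ : Summable fun j => (a j τ - α j) ^ 2 :=
      summable_sq_sub_of_sq (ha.summable_sq τ hτ0) hαsum
    have hsq1 : (a (k + 1) τ - α (k + 1)) ^ 2 ≤ B :=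
      (hsumτ.le_tsum (k + 1) fun j _ => sq_nonneg _).trans hBτ
    have hsq2 : (a (k + 2) τ - α (k + 2)) ^ 2 ≤ B :=
      (hsumτ.le_tsum (k + 2) fun j _ => sq_nonneg _).trans hBτ
    have habs1 : |a (k + 1) τ - α (k + 1)| ≤ (1 + B) / 2 :=
      (abs_le_one_add_sq_half _).trans (by linarith)
    have habs2 : |a (k + 2) τ - α (k + 2)| ≤ (1 + B) / 2 :=
      (abs_le_one_add_sq_half _).trans (by linarith)
    have hα21 : α (k + 2) ≤ α (k + 1) := by
      rw [hαK, hαK, pow_succ, ← mul_assoc]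
      exact mul_le_of_le_one_right (by positivity) CFP.q_lt_one.le
    have hcross' : -((a (k + 1) τ - α (k + 1)) * (a (k + 2) τ - α (k + 2))) ≤
        α (k + 1) * (1 + B) := by
      have e1 := mul_le_mul_of_nonneg_left habs2 (hαnn (k + 1))
      have e2 : α (k + 2) * |a (k + 1) τ - α (k + 1)| ≤ α (k + 1) * ((1 + B) / 2) :=
        (mul_le_mul_of_nonneg_right hα21 (abs_nonneg _)).trans
          (mul_le_mul_of_nonneg_left habs1 (hαnn (k + 1)))
      linarith
    -- `K s^{2(k+1)} α_{k+1} (1 + B) = K²(1 + B) s^{k+1}`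
    have hcoef : CFP.K f₀ * CFP.s ^ (2 * (k + 1)) * (α (k + 1) * (1 + B)) =
        CFP.K f₀ ^ 2 * (1 + B) * CFP.s ^ (k + 1) := by
      rw [hαK]
      calc CFP.K f₀ * CFP.s ^ (2 * (k + 1)) * (CFP.K f₀ * CFP.q ^ (k + 1) * (1 + B))
          = CFP.K f₀ ^ 2 * (1 + B) * CFP.s ^ (k + 1) * (CFP.s * CFP.q) ^ (k + 1) := by ring
        _ = CFP.K f₀ ^ 2 * (1 + B) * CFP.s ^ (k + 1) := by rw [hsq, one_pow, mul_one]
    have hKs : 0 ≤ CFP.K f₀ * CFP.s ^ (2 * (k + 1)) := by positivity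
    have hmain := mul_le_mul_of_nonneg_left hcross' hKs
    have hG1 : G (k + 1) τ = 2 * ∑ j ∈ range (k + 2),
        (a j τ - α j) * (rhs (5 / 2) 0 (force f₀) (fun i => a i τ) j - rhs (5 / 2) 0 (force f₀) α j) := by
      rw [hG]
    have hG0 : G k τ = 2 * ∑ j ∈ range (k + 1),
        (a j τ - α j) * (rhs (5 / 2) 0 (force f₀) (fun i => a i τ) j - rhs (5 / 2) 0 (force f₀) α j) := by
      rw [hG]
    have hPτ : P τ = ∑ j ∈ range (k + 1), dSeq CFP.s (fun i => a i τ - α i) j ^ 2 := by rw [hP]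
    rw [hG1, hG0, hPτ, hC]
    linarith
  -- integrate
  have hI : (∫ τ in t₁..t₂, G (k + 1) τ + G k τ) ≤
      ∫ τ in t₁..t₂, (-(2 * (CFP.K f₀ * CFP.q)) * P τ + C) :=
    intervalIntegral.integral_mono_on h12 ((hGi (k + 1)).add (hGi k))
      ((hPi.const_mul _).add intervalIntegrable_const) hpt
  rw [intervalIntegral.integral_add (hGi (k + 1)) (hGi k),
    intervalIntegral.integral_add (hPi.const_mul _) intervalIntegrable_const,
    intervalIntegral.integral_const_mul, intervalIntegral.integral_const, smul_eq_mul] at hI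
  have e1 : ∑ j ∈ range (k + 1), (a j t₂ - α j) ^ 2 - ∑ j ∈ range (k + 1), (a j t₁ - α j) ^ 2 =
      ∫ τ in t₁..t₂, G k τ := by
    rw [ha.truncPert_eq hαfix k ht₁ h12, hG]
  have e2 : ∑ j ∈ range (k + 1 + 1), (a j t₂ - α j) ^ 2 - ∑ j ∈ range (k + 1 + 1), (a j t₁ - α j) ^ 2 =
      ∫ τ in t₁..t₂, G (k + 1) τ := by
    rw [ha.truncPert_eq hαfix (k + 1) ht₁ h12, hG]
  have e3 : (∫ τ in t₁..t₂, ∑ j ∈ range (k + 1), dSeq CFP.s (fun i => a i τ - α i) j ^ 2) =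
      ∫ τ in t₁..t₂, P τ := by rw [hP]
  have e4 : (t₂ - t₁) * C = 2 * CFP.K f₀ ^ 2 * (1 + B) * (t₂ - t₁) * CFP.s ^ (k + 1) := by
    rw [hC]; ring
  rw [e3]
  linarith

/-! ### Thm. 4.2: the contradiction argument and the limit `k → ∞` -/

/-- **Thm. 4.2, the heart of the proof** ((4.19)–(4.27): "we have shown that for any `N > 0` there
exists `k > N`, such that (4.27)"), scaling-covariant: for a solution of the inviscid model with
non-negative datum, `0 ≤ t₁ ≤ t₂` and every `N` there is `k ≥ N` with
`Σ_{j≤k}b_j(t₂)² − Σ_{j≤k}b_j(t₁)² ≤ −θKq∫_{t₁}^{t₂}Σ_{j≤k}D_j²`.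
Proof as printed: otherwise ((4.19)) `T_{k+1} > (2−θ)T_k` for `k ≥ N` (from (4.20), cf.
(4.21)–(4.23)), so `T_k` grows at least like `(2−θ)^k` ((4.24)–(4.25)), while (4.5) integrated
bounds `T_k ≤ A + Cs^{k+1}` ((4.26)); as `2 − θ > s` this is absurd ("the right hand side goes to
`−∞` as `j → ∞`"). [cite: CheskidovFriedlanderPavlovic2010, Thm 4.2 (4.19)–(4.27) p.8–9] -/
theorem exists_trunc_le (hf : 0 < f₀) (ha : IsSolution (5 / 2) 0 (force f₀) a)
    (h0 : ∀ j, 0 ≤ a j 0) {t₁ t₂ : ℝ} (ht₁ : 0 ≤ t₁) (h12 : t₁ ≤ t₂) (N : ℕ) :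
    ∃ k, N ≤ k ∧
      ∑ j ∈ range (k + 1), (a j t₂ - inviscidFixedPoint (5 / 2) f₀ j) ^ 2
          - ∑ j ∈ range (k + 1), (a j t₁ - inviscidFixedPoint (5 / 2) f₀ j) ^ 2 ≤
        -(CFP.θ * (CFP.K f₀ * CFP.q)) * ∫ τ in t₁..t₂, ∑ j ∈ range (k + 1),
          dSeq CFP.s (fun i => a i τ - inviscidFixedPoint (5 / 2) f₀ i) j ^ 2 := by
  set α : ℕ → ℝ := inviscidFixedPoint (5 / 2) f₀ with hαdef
  have hαsum : Summable fun j => α j ^ 2 := (CFP.isFixedPoint hf.le).1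
  have hst' : Icc t₁ t₂ ⊆ Ici 0 := fun τ hτ => ht₁.trans hτ.1
  have hKq : 0 < CFP.K f₀ * CFP.q := mul_pos (CFP.K_pos hf) CFP.q_pos
  have hθ := CFP.θ_pos
  have hs1 := CFP.one_lt_s
  have hs2 := CFP.s_lt_two
  have hs0 := CFP.s_pos
  -- the quantities `E_k(t)` and `T_k`
  set E : ℕ → ℝ → ℝ := fun k t => ∑ j ∈ range (k + 1), (a j t - α j) ^ 2 with hE
  set T : ℕ → ℝ := fun k => ∫ τ in t₁..t₂, ∑ j ∈ range (k + 1),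
    dSeq CFP.s (fun i => a i τ - α i) j ^ 2 with hT
  have hPc : ∀ n, ContinuousOn (fun τ => ∑ j ∈ range (n + 1),
      dSeq CFP.s (fun i => a i τ - α i) j ^ 2) (Icc t₁ t₂) := fun n =>
    (continuousOn_finsetSum _ fun j _ => (ha.continuousOn_dSeq CFP.s α j).pow 2).mono hst'
  have hT0 : ∀ k, 0 ≤ T k := fun k =>
    intervalIntegral.integral_nonneg h12 fun τ _ => sum_nonneg fun j _ => sq_nonneg _
  have hE0 : ∀ k t, 0 ≤ E k t := fun k t => sum_nonneg fun j _ => sq_nonneg _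
  have hEle : ∀ k, E k t₁ ≤ normSq (fun j => a j t₁ - α j) := fun k =>
    (summable_sq_sub_of_sq (ha.summable_sq t₁ ht₁) hαsum).sum_le_tsum _ fun j _ => sq_nonneg _
  -- the a priori bound and the two integrated inequalities
  obtain ⟨B, hB0, hB⟩ := exists_normSq_pert_le hf ha h0 (ht₁.trans h12)
  have hI : ∀ k, E k t₂ - E k t₁ ≤ CFP.K f₀ * CFP.q * (T (k + 1) - 2 * T k) := fun k =>
    inviscid_truncPert_le hf ha h0 k ht₁ h12
  have hII : ∀ k, (E k t₂ + E (k + 1) t₂) - (E k t₁ + E (k + 1) t₁) ≤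
      -(2 * (CFP.K f₀ * CFP.q)) * T k + 2 * CFP.K f₀ ^ 2 * (1 + B) * (t₂ - t₁) * CFP.s ^ (k + 1) :=
    fun k => inviscid_truncPert_two_le hf ha h0 k ht₁ h12 hB
  have hK0 := CFP.K_pos hf
  have hq0 := CFP.q_pos
  have h2θ : 0 ≤ 2 - CFP.θ := by unfold CFP.θ; linarith
  by_contra H
  push Not at H
  -- (4.21) ⇒ (4.22): `T_{k+1} > (2 − θ)T_k` for `k ≥ N`
  have hgrow : ∀ k, N ≤ k → (2 - CFP.θ) * T k < T (k + 1) := by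
    intro k hk
    have h1 := H k hk
    have h2 := hI k
    by_contra h3
    push Not at h3
    have := mul_le_mul_of_nonneg_left h3 hKq.le
    nlinarith
  have hTpos : 0 < T (N + 1) := by
    have := hgrow N le_rfl
    nlinarith [mul_nonneg h2θ (hT0 N)]
  -- (4.24): geometric growth
  have hlow : ∀ i : ℕ, (2 - CFP.θ) ^ i * T (N + 1) ≤ T (N + 1 + i) := by
    intro i
    induction i with
    | zero => simp
    | succ i ih =>
      have hg := hgrow (N + 1 + i) (by omega)
      rw [show N + 1 + (i + 1) = N + 1 + i + 1 by omega]
      calc (2 - CFP.θ) ^ (i + 1) * T (N + 1) = (2 - CFP.θ) * ((2 - CFP.θ) ^ i * T (N + 1)) := by ring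
        _ ≤ (2 - CFP.θ) * T (N + 1 + i) := mul_le_mul_of_nonneg_left ih h2θ
        _ ≤ T (N + 1 + i + 1) := hg.le
  -- (4.25): the upper bound `2Kq T_k ≤ 2|b(t₁)|² + C s^{k+1}`
  set Cst : ℝ := 2 * CFP.K f₀ ^ 2 * (1 + B) * (t₂ - t₁) with hCst
  have hCst0 : 0 ≤ Cst := by
    have : 0 ≤ t₂ - t₁ := by linarith
    positivity
  have hup : ∀ k, 2 * (CFP.K f₀ * CFP.q) * T k ≤
      2 * normSq (fun j => a j t₁ - α j) + Cst * CFP.s ^ (k + 1) := by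
    intro k
    have h := hII k
    have := hE0 k t₂
    have := hE0 (k + 1) t₂
    have := hEle k
    have := hEle (k + 1)
    nlinarith
  -- combine: `((2−θ)/s)^i ≤ M₀` for all `i`, contradicting `(2−θ)/s > 1`
  set nb : ℝ := normSq (fun j => a j t₁ - α j) with hnb
  have hnb0 : 0 ≤ nb := tsum_nonneg fun j => sq_nonneg _
  set M₀ : ℝ := (2 * nb + Cst * CFP.s ^ (N + 2)) / (2 * (CFP.K f₀ * CFP.q) * T (N + 1)) with hM₀
  have hden : 0 < 2 * (CFP.K f₀ * CFP.q) * T (N + 1) := by positivity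
  have hbound : ∀ i : ℕ, ((2 - CFP.θ) / CFP.s) ^ i ≤ M₀ := by
    intro i
    have h1 := hlow i
    have h2 := hup (N + 1 + i)
    have hsi : 1 ≤ CFP.s ^ i := one_le_pow₀ hs1.le
    have hsi0 : 0 < CFP.s ^ i := pow_pos hs0 i
    have e : Cst * CFP.s ^ (N + 1 + i + 1) = Cst * CFP.s ^ (N + 2) * CFP.s ^ i := by
      rw [show N + 1 + i + 1 = N + 2 + i by omega, pow_add]; ring
    rw [e] at h2
    have h3 : 2 * nb ≤ 2 * nb * CFP.s ^ i := by nlinarith [mul_nonneg hnb0 (sub_nonneg.2 hsi)]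
    have key : (2 - CFP.θ) ^ i * (2 * (CFP.K f₀ * CFP.q) * T (N + 1)) ≤
        (2 * nb + Cst * CFP.s ^ (N + 2)) * CFP.s ^ i :=
      calc (2 - CFP.θ) ^ i * (2 * (CFP.K f₀ * CFP.q) * T (N + 1))
          = 2 * (CFP.K f₀ * CFP.q) * ((2 - CFP.θ) ^ i * T (N + 1)) := by ring
        _ ≤ 2 * (CFP.K f₀ * CFP.q) * T (N + 1 + i) := mul_le_mul_of_nonneg_left h1 (by positivity)
        _ ≤ 2 * nb + Cst * CFP.s ^ (N + 2) * CFP.s ^ i := h2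
        _ ≤ (2 * nb + Cst * CFP.s ^ (N + 2)) * CFP.s ^ i := by rw [add_mul]; linarith
    rw [div_pow, div_le_iff₀ hsi0]
    calc (2 - CFP.θ) ^ i
        = (2 - CFP.θ) ^ i * (2 * (CFP.K f₀ * CFP.q) * T (N + 1)) / (2 * (CFP.K f₀ * CFP.q) * T (N + 1)) := by
          field_simp
      _ ≤ (2 * nb + Cst * CFP.s ^ (N + 2)) * CFP.s ^ i / (2 * (CFP.K f₀ * CFP.q) * T (N + 1)) :=
          div_le_div_of_nonneg_right key hden.le
      _ = M₀ * CFP.s ^ i := by rw [hM₀]; ring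
  obtain ⟨i, hi⟩ := ((tendsto_pow_atTop_atTop_of_one_lt CFP.one_lt_ratio).eventually_gt_atTop M₀).exists
  exact absurd (hbound i) (not_le.mpr hi)

/-- **Thm. 4.2, (4.27) → (4.28), truncated on the right** ("taking a limit as `N → ∞` and using
Levi's convergence theorem"), scaling-covariant: for a solution of the inviscid model with
non-negative datum, `b = a − α⁰`, `0 ≤ t₁ ≤ t₂` and every `m`,
`|b(t₂)|² − |b(t₁)|² ≤ −θKq∫_{t₁}^{t₂}Σ_{j≤m}D_j²` ((4.18)/(4.28) with `∫|d|²` truncated; the full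
`∫|d|²` is the supremum over `m`). [cite: CheskidovFriedlanderPavlovic2010, Thm 4.2 (4.18) p.8 and (4.27)–(4.28) p.9–10] -/
theorem normSq_pert_le_dSeq (hf : 0 < f₀) (ha : IsSolution (5 / 2) 0 (force f₀) a)
    (h0 : ∀ j, 0 ≤ a j 0) (m : ℕ) {t₁ t₂ : ℝ} (ht₁ : 0 ≤ t₁) (h12 : t₁ ≤ t₂) :
    normSq (fun j => a j t₂ - inviscidFixedPoint (5 / 2) f₀ j)
        - normSq (fun j => a j t₁ - inviscidFixedPoint (5 / 2) f₀ j) ≤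
      -(CFP.θ * (CFP.K f₀ * CFP.q)) * ∫ τ in t₁..t₂, ∑ j ∈ range (m + 1),
        dSeq CFP.s (fun i => a i τ - inviscidFixedPoint (5 / 2) f₀ i) j ^ 2 := by
  set α : ℕ → ℝ := inviscidFixedPoint (5 / 2) f₀ with hαdef
  have hαsum : Summable fun j => α j ^ 2 := (CFP.isFixedPoint hf.le).1
  have hst' : Icc t₁ t₂ ⊆ Ici 0 := fun τ hτ => ht₁.trans hτ.1
  have hθKq : 0 ≤ CFP.θ * (CFP.K f₀ * CFP.q) :=
    mul_nonneg CFP.θ_pos.le (mul_nonneg (CFP.K_nonneg f₀) CFP.q_pos.le)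
  have hPc : ∀ n, ContinuousOn (fun τ => ∑ j ∈ range (n + 1),
      dSeq CFP.s (fun i => a i τ - α i) j ^ 2) (Icc t₁ t₂) := fun n =>
    (continuousOn_finsetSum _ fun j _ => (ha.continuousOn_dSeq CFP.s α j).pow 2).mono hst'
  refine le_of_forall_pos_le_add fun ε hε => ?_
  have hl₁ := Metric.tendsto_atTop.1 (ha.tendsto_truncPert hαsum ht₁) (ε / 2) (half_pos hε)
  have hl₂ := Metric.tendsto_atTop.1 (ha.tendsto_truncPert hαsum (ht₁.trans h12)) (ε / 2) (half_pos hε)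
  obtain ⟨N₁, hN₁⟩ := hl₁
  obtain ⟨N₂, hN₂⟩ := hl₂
  obtain ⟨k, hk, hdec⟩ := exists_trunc_le hf ha h0 ht₁ h12 (max m (max N₁ N₂))
  have hkm : m ≤ k := le_trans (le_max_left _ _) hk
  have hk1 : N₁ ≤ k := le_trans ((le_max_left _ _).trans (le_max_right _ _)) hk
  have hk2 : N₂ ≤ k := le_trans ((le_max_right _ _).trans (le_max_right _ _)) hk
  have hTm : (∫ τ in t₁..t₂, ∑ j ∈ range (m + 1), dSeq CFP.s (fun i => a i τ - α i) j ^ 2) ≤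
      ∫ τ in t₁..t₂, ∑ j ∈ range (k + 1), dSeq CFP.s (fun i => a i τ - α i) j ^ 2 :=
    intervalIntegral.integral_mono_on h12 ((hPc m).intervalIntegrable_of_Icc h12)
      ((hPc k).intervalIntegrable_of_Icc h12) fun τ _ =>
        sum_le_sum_of_subset_of_nonneg (range_mono (by omega)) fun _ _ _ => sq_nonneg _
  have d1 := hN₁ k hk1
  have d2 := hN₂ k hk2
  rw [Real.dist_eq, abs_lt] at d1 d2
  nlinarith [mul_le_mul_of_nonneg_left hTm hθKq, d1.1, d1.2, d2.1, d2.2]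

/-- **(4.32) truncated** (Thm. 4.2 combined with (4.31)), scaling-covariant: for a solution of the
inviscid model with non-negative datum, `b = a − α⁰`, `0 ≤ t₁ ≤ t₂` and every `m`,
`|b(t₂)|² − |b(t₁)|² ≤ −(θKq/S)∫_{t₁}^{t₂}Σ_{j≤m}b_j²`.
[cite: CheskidovFriedlanderPavlovic2010, Thm 4.4 (4.31)–(4.32) p.10] -/
theorem normSq_pert_le_trunc (hf : 0 < f₀) (ha : IsSolution (5 / 2) 0 (force f₀) a)
    (h0 : ∀ j, 0 ≤ a j 0) (m : ℕ) {t₁ t₂ : ℝ} (ht₁ : 0 ≤ t₁) (h12 : t₁ ≤ t₂) :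
    normSq (fun j => a j t₂ - inviscidFixedPoint (5 / 2) f₀ j)
        - normSq (fun j => a j t₁ - inviscidFixedPoint (5 / 2) f₀ j) ≤
      -(CFP.θ * (CFP.K f₀ * CFP.q) / CFP.S) * ∫ τ in t₁..t₂, ∑ j ∈ range (m + 1),
        (a j τ - inviscidFixedPoint (5 / 2) f₀ j) ^ 2 := by
  set α : ℕ → ℝ := inviscidFixedPoint (5 / 2) f₀ with hαdef
  have hst' : Icc t₁ t₂ ⊆ Ici 0 := fun τ hτ => ht₁.trans hτ.1
  have hS := CFP.S_pos
  have hθKq : 0 ≤ CFP.θ * (CFP.K f₀ * CFP.q) :=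
    mul_nonneg CFP.θ_pos.le (mul_nonneg (CFP.K_nonneg f₀) CFP.q_pos.le)
  have h := normSq_pert_le_dSeq hf ha h0 m ht₁ h12
  have hPc : ContinuousOn (fun τ => ∑ j ∈ range (m + 1),
      dSeq CFP.s (fun i => a i τ - α i) j ^ 2) (Icc t₁ t₂) :=
    (continuousOn_finsetSum _ fun j _ => (ha.continuousOn_dSeq CFP.s α j).pow 2).mono hst'
  have hEc : ContinuousOn (fun τ => ∑ j ∈ range (m + 1), (a j τ - α j) ^ 2) (Icc t₁ t₂) :=
    (continuousOn_finsetSum _ fun j _ => ((ha.continuousOn j).sub continuousOn_const).pow 2).mono hst'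
  -- (4.31) pointwise, then integrated: `∫Σb_j² ≤ S∫ΣD_j²`
  have hpt : ∀ τ ∈ Icc t₁ t₂, ∑ j ∈ range (m + 1), (a j τ - α j) ^ 2 ≤
      CFP.S * ∑ j ∈ range (m + 1), dSeq CFP.s (fun i => a i τ - α i) j ^ 2 := by
    intro τ _
    have h1 := sum_sq_le_dSeq CFP.s_mul_q (fun i => a i τ - α i) m
    have h2 := CFP.sum_le_S m
    have h3 : 0 ≤ ∑ j ∈ range (m + 1), dSeq CFP.s (fun i => a i τ - α i) j ^ 2 :=
      sum_nonneg fun j _ => sq_nonneg _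
    exact h1.trans (mul_le_mul_of_nonneg_right h2 h3)
  have hI : (∫ τ in t₁..t₂, ∑ j ∈ range (m + 1), (a j τ - α j) ^ 2) ≤
      ∫ τ in t₁..t₂, CFP.S * ∑ j ∈ range (m + 1), dSeq CFP.s (fun i => a i τ - α i) j ^ 2 :=
    intervalIntegral.integral_mono_on h12 (hEc.intervalIntegrable_of_Icc h12)
      ((hPc.intervalIntegrable_of_Icc h12).const_mul _) hpt
  rw [intervalIntegral.integral_const_mul] at hI
  have e : -(CFP.θ * (CFP.K f₀ * CFP.q) / CFP.S) * (CFP.S * ∫ τ in t₁..t₂, ∑ j ∈ range (m + 1),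
      dSeq CFP.s (fun i => a i τ - α i) j ^ 2) = -(CFP.θ * (CFP.K f₀ * CFP.q)) *
        ∫ τ in t₁..t₂, ∑ j ∈ range (m + 1), dSeq CFP.s (fun i => a i τ - α i) j ^ 2 := by
    field_simp
  have hθS : 0 ≤ CFP.θ * (CFP.K f₀ * CFP.q) / CFP.S := div_nonneg hθKq hS.le
  have := mul_le_mul_of_nonneg_left hI hθS
  linarith

/-! ### "Gronwall" from the truncated integral inequality (as in the discharge of CF 2009 Thm. 3.4) -/

/-- **Gronwall's inequality in the form the printed proofs use it**, packaged: if along a solution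
`a` (any parameters) and for a square-summable `α` the perturbation `φ(t) = |a(t) − α|²` satisfies
`φ(t) − φ(s) ≤ −β∫_s^tΣ_{j≤m}(a_j − α_j)²` for all `0 ≤ s ≤ t` and every truncation `m`
(`β > 0`), then `φ(t) ≤ φ(0)e^{−(β/2)t}`.  Steps: `φ` is non-increasing; by monotone convergence
`φ(t) − φ(s) ≤ −β∫_s^tφ ≤ −β(t−s)φ(t)`; iterate over `n` equal steps and use `e^{u/2} ≤ 1 + u`
(`u ≤ 1`).  (The argument of `GlobalAttractor.lean`, abstracted from its hypotheses.)
[cite: CheskidovFriedlanderPavlovic2010, Thm 4.4 (4.32)–(4.34) p.10] [cite: CheskidovFriedlander2009, Thm 3.4 (3.11)–(3.12) p.8–9] -/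
theorem IsSolution.normSq_exp_decay_of_trunc {c ν : ℝ} {f : ℕ → ℝ} {α : ℕ → ℝ}
    (ha : IsSolution c ν f a) (hα : Summable fun j => α j ^ 2) {β : ℝ} (hβ : 0 < β)
    (hkey : ∀ m : ℕ, ∀ s t : ℝ, 0 ≤ s → s ≤ t →
      normSq (fun j => a j t - α j) - normSq (fun j => a j s - α j) ≤
        -β * ∫ τ in s..t, ∑ j ∈ range (m + 1), (a j τ - α j) ^ 2)
    {t : ℝ} (ht : 0 ≤ t) :
    normSq (fun j => a j t - α j) ≤ normSq (fun j => a j 0 - α j) * Real.exp (-(β / 2 * t)) := by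
  set φ : ℝ → ℝ := fun τ => normSq (fun j => a j τ - α j) with hφ
  have hφ0 : ∀ τ, 0 ≤ φ τ := fun τ => tsum_nonneg fun j => sq_nonneg _
  have hcont := ha.continuousOn
  -- step 1: `φ` is non-increasing on `[0,∞)`
  have hanti : ∀ s u : ℝ, 0 ≤ s → s ≤ u → φ u ≤ φ s := by
    intro s u hs hsu
    have h := hkey 0 s u hs hsu
    have hI : 0 ≤ ∫ τ in s..u, ∑ j ∈ range (0 + 1), (a j τ - α j) ^ 2 :=
      intervalIntegral.integral_nonneg hsu fun τ _ => sum_nonneg fun j _ => sq_nonneg _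
    nlinarith [mul_nonneg hβ.le hI]
  -- step 2: `φ(u)(1 + β(u − s)) ≤ φ(s)` (monotone convergence in `m`)
  have hstep : ∀ s u : ℝ, 0 ≤ s → s ≤ u → φ u * (1 + β * (u - s)) ≤ φ s := by
    intro s u hs hsu
    set F : ℕ → ℝ → ℝ := fun m τ => ∑ j ∈ range (m + 1), (a j τ - α j) ^ 2 with hF
    have hmeas : MeasurableSet (Ioc s u) := measurableSet_Ioc
    have hsu' : Icc s u ⊆ Ici 0 := fun τ hτ => hs.trans hτ.1
    have hFc : ∀ m, ContinuousOn (F m) (Icc s u) := fun m =>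
      (continuousOn_finsetSum _ fun j _ => ((hcont j).sub continuousOn_const).pow 2).mono hsu'
    have hFint : ∀ m, Integrable (F m) (volume.restrict (Ioc s u)) := fun m =>
      ((hFc m).integrableOn_Icc).mono_set Ioc_subset_Icc_self
    have hae : ∀ᵐ τ ∂(volume.restrict (Ioc s u)), τ ∈ Ioc s u := ae_restrict_mem hmeas
    have hmono : ∀ᵐ τ ∂(volume.restrict (Ioc s u)), Monotone fun m => F m τ := by
      filter_upwards with τ
      intro m n hmn
      exact sum_le_sum_of_subset_of_nonneg (range_mono (by omega)) fun j _ _ => sq_nonneg _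
    have htend : ∀ᵐ τ ∂(volume.restrict (Ioc s u)), Tendsto (fun m => F m τ) atTop (𝓝 (φ τ)) := by
      filter_upwards [hae] with τ hτ
      exact ha.tendsto_truncPert hα (hs.trans hτ.1.le)
    have hφmeas : AEStronglyMeasurable φ (volume.restrict (Ioc s u)) :=
      aestronglyMeasurable_of_tendsto_ae atTop (fun m => (hFint m).aestronglyMeasurable) htend
    have hanti' : ∀ τ ∈ Ioc s u, φ u ≤ φ τ ∧ φ τ ≤ φ s := fun τ hτ =>
      ⟨hanti τ u (hs.trans hτ.1.le) hτ.2, hanti s τ hs hτ.1.le⟩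
    have hφbd : ∀ᵐ τ ∂(volume.restrict (Ioc s u)), ‖φ τ‖ ≤ φ s := by
      filter_upwards [hae] with τ hτ
      rw [Real.norm_eq_abs, abs_of_nonneg (hφ0 τ)]
      exact (hanti' τ hτ).2
    have hconst : ∀ C : ℝ, Integrable (fun _ : ℝ => C) (volume.restrict (Ioc s u)) := fun C =>
      ((continuousOn_const (c := C)).integrableOn_Icc (a := s) (b := u)).mono_set Ioc_subset_Icc_self
    have hφint : Integrable φ (volume.restrict (Ioc s u)) := (hconst (φ s)).mono' hφmeas hφbd
    have hlimI : Tendsto (fun m => ∫ τ, F m τ ∂(volume.restrict (Ioc s u))) atTop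
        (𝓝 (∫ τ, φ τ ∂(volume.restrict (Ioc s u)))) :=
      integral_tendsto_of_tendsto_of_monotone hFint hφint hmono htend
    have hineq : ∀ m, φ u - φ s ≤ -β * ∫ τ, F m τ ∂(volume.restrict (Ioc s u)) := fun m => by
      have h := hkey m s u hs hsu
      rwa [intervalIntegral.integral_of_le hsu] at h
    have hstep1 : φ u - φ s ≤ -β * ∫ τ, φ τ ∂(volume.restrict (Ioc s u)) :=
      ge_of_tendsto (hlimI.const_mul (-β)) (Eventually.of_forall hineq)
    have hlow : (u - s) * φ u ≤ ∫ τ, φ τ ∂(volume.restrict (Ioc s u)) := by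
      have h := setIntegral_mono_on (hconst (φ u)) hφint hmeas fun τ hτ => (hanti' τ hτ).1
      rwa [setIntegral_const, Real.volume_real_Ioc_of_le hsu, smul_eq_mul] at h
    nlinarith [mul_le_mul_of_nonneg_left hlow hβ.le]
  -- step 3: discrete Gronwall `φ(nh)(1 + βh)^n ≤ φ(0)`
  have hiter : ∀ {h : ℝ}, 0 ≤ h → ∀ n : ℕ, φ ((n : ℝ) * h) * (1 + β * h) ^ n ≤ φ 0 := by
    intro h hh n
    induction n with
    | zero => simp
    | succ n ih =>
      have hs : (0 : ℝ) ≤ (n : ℝ) * h := by positivity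
      have hsu : (n : ℝ) * h ≤ ((n + 1 : ℕ) : ℝ) * h := by push_cast; nlinarith
      have step := hstep _ _ hs hsu
      have e : ((n + 1 : ℕ) : ℝ) * h - (n : ℝ) * h = h := by push_cast; ring
      rw [e] at step
      have hq : 0 ≤ (1 + β * h) ^ n := by positivity
      calc φ (((n + 1 : ℕ) : ℝ) * h) * (1 + β * h) ^ (n + 1)
          = φ (((n + 1 : ℕ) : ℝ) * h) * (1 + β * h) * (1 + β * h) ^ n := by rw [pow_succ]; ring
        _ ≤ φ ((n : ℝ) * h) * (1 + β * h) ^ n := mul_le_mul_of_nonneg_right step hq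
        _ ≤ φ 0 := ih
  -- step 4: choose `n ≥ βt` steps of length `t/n`
  obtain ⟨n, hn, hn0⟩ : ∃ n : ℕ, β * t ≤ n ∧ 0 < n :=
    ⟨⌈β * t⌉₊ + 1, by push_cast; linarith [Nat.le_ceil (β * t)], by positivity⟩
  have hn' : (0 : ℝ) < n := by exact_mod_cast hn0
  set h : ℝ := t / n with hhdef
  have hh : 0 ≤ h := by positivity
  have hnh : (n : ℝ) * h = t := by rw [hhdef]; field_simp
  have hit := hiter hh n
  rw [hnh] at hit
  have hu0 : 0 ≤ β * h := by positivity
  have hu1 : β * h ≤ 1 := by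
    rw [hhdef, show β * (t / n) = β * t / n by ring, div_le_one hn']
    exact hn
  have hexp : Real.exp (β / 2 * t) ≤ (1 + β * h) ^ n := by
    have h1 : Real.exp (β * h / 2) ≤ 1 + β * h := exp_half_le_one_add hu0 hu1
    calc Real.exp (β / 2 * t) = Real.exp (β * h / 2) ^ n := by
          rw [← Real.exp_nat_mul, ← hnh]; ring_nf
      _ ≤ (1 + β * h) ^ n := pow_le_pow_left₀ (Real.exp_pos _).le h1 n
  have hmain : φ t * Real.exp (β / 2 * t) ≤ φ 0 :=
    (mul_le_mul_of_nonneg_left hexp (hφ0 t)).trans hit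
  have hEpos : 0 < Real.exp (β / 2 * t) := Real.exp_pos _
  rw [Real.exp_neg, le_mul_inv_iff₀ hEpos]
  exact hmain

/-! ### Theorem 4.4 and CF 2009 Theorem 4.1 -/

/-- **Cheskidov–Friedlander–Pavlović 2010, Theorem 4.4 — PROVED** (discharge of the named fact
`CheskidovFriedlanderPavlovic2010_thm44`): there is a universal `β > 0` (here `β = θq/(2S)`,
`θ = (2 − 2^{5/6})/2`, `q = 2^{−5/6}`, `S = Σ_j(j+1)q^{2j}`) such that for every `f₀ > 0` and every
solution `a` of the inviscid dyadic model (`λ = 2^{5/2}`) with `a_j(0) ≥ 0`,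
`|a(t) − α⁰|² ≤ |a(0) − α⁰|²e^{−β√(2^{5/6}f₀)t}` for all `t ≥ 0`, `α⁰_j = 2^{5/12}√f₀·2^{−5j/6}` the
fixed point. [cite: CheskidovFriedlanderPavlovic2010, Thm 4.4 (4.30) p.10] -/
theorem CheskidovFriedlanderPavlovic2010_thm44_holds : CheskidovFriedlanderPavlovic2010_thm44 := by
  refine ⟨CFP.θ * CFP.q / (2 * CFP.S), by
    have := CFP.θ_pos; have := CFP.q_pos; have := CFP.S_pos; positivity, ?_⟩
  intro f₀ hf a ha h0 t ht
  have hαsum : Summable fun j => inviscidFixedPoint (5 / 2) f₀ j ^ 2 := (CFP.isFixedPoint hf.le).1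
  have hβ : 0 < CFP.θ * (CFP.K f₀ * CFP.q) / CFP.S :=
    div_pos (mul_pos CFP.θ_pos (mul_pos (CFP.K_pos hf) CFP.q_pos)) CFP.S_pos
  have h := ha.normSq_exp_decay_of_trunc hαsum hβ
    (fun m s u hs hsu => normSq_pert_le_trunc hf ha h0 m hs hsu) ht
  rw [← CFP.K_eq_sqrt f₀]
  convert h using 3
  ring

/-- **Cheskidov–Friedlander 2009, Theorem 4.1 (the inviscid anomalous dissipation rate), at
`c = 5/2` — now unconditional**: for every solution `a` of the inviscid model (force `f₀ > 0` on the
first shell) with non-negative `ℓ²` datum, the time average of the anomalous dissipation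
`T⁻¹[∫₀ᵀ(a(t),f)dt − ½(|a(T)|² − |a(0)|²)]` tends to `ε_d = f₀α⁰₀` as `T → ∞`
(`CheskidovFriedlander2009_thm41_of_thm44` fed with `CheskidovFriedlanderPavlovic2010_thm44_holds`).
[cite: CheskidovFriedlander2009, Thm 4.1 p.9] [cite: CheskidovFriedlanderPavlovic2010, Thm 4.4 p.10 and §6 p.14–15] -/
theorem CheskidovFriedlander2009_thm41 {f₀ : ℝ} (hf : 0 < f₀) {a : ℕ → ℝ → ℝ}
    (ha : IsSolution (5 / 2) 0 (force f₀) a) (h0 : ∀ j, 0 ≤ a j 0) :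
    Tendsto (fun T : ℝ => T⁻¹ * ((∫ t in (0 : ℝ)..T, f₀ * a 0 t)
        - (normSq (fun j => a j T) - normSq (fun j => a j 0)) / 2)) atTop
      (𝓝 (epsilonD (5 / 2) f₀)) :=
  CheskidovFriedlander2009_thm41_of_thm44 CheskidovFriedlanderPavlovic2010_thm44_holds hf ha h0

end Literature.Analysis.FluidPDE.CheskidovFriedlander2009

end
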